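import Summits.KontsevichZagierPeriods.Zeta5Search.Certificates.RayH1KernelClassCWR1P0
import Summits.KontsevichZagierPeriods.Zeta5Search.Certificates.RayH1KernelClassCWR1P1
import Summits.KontsevichZagierPeriods.Zeta5Search.Certificates.RayH1KernelClassCWR1P2
import Summits.KontsevichZagierPeriods.Zeta5Search.Certificates.RayH1KernelClassCWR1P3
import Summits.KontsevichZagierPeriods.Zeta5Search.Certificates.RayH1KernelClassCWR1P4
import Summits.KontsevichZagierPeriods.Zeta5Search.Certificates.RayH1KernelClassCWR1P5
import Summits.KontsevichZagierPeriods.Zeta5Search.Certificates.RayH1KernelClassCWR1P6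
import Summits.KontsevichZagierPeriods.Zeta5Search.Certificates.RayH1KernelClassCWR1P7
import Summits.KontsevichZagierPeriods.Zeta5Search.Certificates.RayH1KernelClassCWR1P8
import Summits.KontsevichZagierPeriods.Zeta5Search.Certificates.RayH1KernelClassCWR1P9
import HarnessLib

/-!
# ζ(5) search — certificates: the CLASS-LAW WINDOW LIST of the ray RayH1, consumption round R1 (TYPER g17 machine, run by p3 g7)

HONEST FRAMING: systematic search; no irrationality claim unless certified.  `p`-adic bookkeeping; nothing about `ζ(5)`.

OUR work (Summit side; typer seat g17's generator `HOME/pub-zeta5-typer-g17/gen/gen_classround.py H1 … R1`, run VERBATIM for the ray H1 by prover seat p3 g7).  The list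
`h1CWR1` of the 120 PROVED windows consumed in round R1 (= the landed adapter chunks `h1CWR1_0`, `h1CWR1_1`, `h1CWR1_2`, `h1CWR1_3`, `h1CWR1_4`, `h1CWR1_5`, `h1CWR1_6`, `h1CWR1_7`, `h1CWR1_8`, `h1CWR1_9`)
and `h1CWR1_holds : ∀ c ∈ h1CWR1, c.Holds` — the hypothesis of `soundChecker_entryOK` for this round's table.
-/

noncomputable section

namespace Summit.KontsevichZagierPeriods.Zeta5Search.RayH1

open Summit.KontsevichZagierPeriods.Zeta5Search.RayKernel

/-- **The class-law window list of round R1.** -/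
def h1CWR1 : List CWin := h1CWR1_0 ++ h1CWR1_1 ++ h1CWR1_2 ++ h1CWR1_3 ++ h1CWR1_4 ++ h1CWR1_5 ++ h1CWR1_6 ++ h1CWR1_7 ++ h1CWR1_8 ++ h1CWR1_9

/-- **Every window holds** (the landed window theorems, by name). -/
theorem h1CWR1_holds : ∀ c ∈ h1CWR1, c.Holds := by
  intro c hc
  simp only [h1CWR1, List.mem_append, or_assoc] at hc
  rcases hc with h0 | h1 | h2 | h3 | h4 | h5 | h6 | h7 | h8 | h9
  · exact h1CWR1_0_holds c h0
  · exact h1CWR1_1_holds c h1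
  · exact h1CWR1_2_holds c h2
  · exact h1CWR1_3_holds c h3
  · exact h1CWR1_4_holds c h4
  · exact h1CWR1_5_holds c h5
  · exact h1CWR1_6_holds c h6
  · exact h1CWR1_7_holds c h7
  · exact h1CWR1_8_holds c h8
  · exact h1CWR1_9_holds c h9

end Summit.KontsevichZagierPeriods.Zeta5Search.RayH1
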